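import Summits.QuantumFields.BalabanUV.Beta.EriceFlowEnclosureB12AsPrintedHistoryContagionProfile
import Literature.MathematicalPhysics.QuantumFieldTheory.Balaban1983to89.T4BetaFlowWellPosed

/-!
# Beta / EriceFlowEnclosureB12AsPrintedHistoryContagionShiftFlow — ASYMPTOTIC FREEDOM IS CONTAGIOUS, part 10: THE CONTINUUM CONTAGION.  For node U2's flow with
# memory `MemFlow B e h` (`T4BetaFlowWellPosed`: `h 0 = e`, `1∕h(m+1)² = 1∕h(m)² + B(h(m+1), h(m+2), …)` — (0.20) IN THE CONTINUUM, the functional looking into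
# the whole ultraviolet future) under a memory profile `T4BetaStationary.MemoryProfile C_m θ γ B` (θ < 1): ONE box solution t with an asymptotically free
# profile `1∕t_a² + β*·m ≤ 1∕t(m)²` makes EVERY box solution h pinned at a small e stay below 2e and carry `1∕(4e²) + (β*∕4)m ≤ 1∕h(m)²` (§12), and then
# two box solutions with the SAME small pin COINCIDE (§13: a θ₁-weighted contraction over ALL physical scales, θ < θ₁ < 1) — node U2's INTRINSIC
# UNIQUENESS `T4BetaFlowWellPosed.memFlow_unique ∕ eq_gstar_of_memFlow` WITHOUT its floor `b ≤ B` and WITHOUT `C_m γ < b(1−θ)`, near zero pin.  Abstract in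
# B; part 11 reads it on the as-printed carrier from [I] THEOREM 2 AS TYPED (β-flow team, prover 1, unit `b2b-balaban-beta-bflow-p1`, gen 36; ROW AP-I·Uc × NODE U2)

HONEST FRAMING (page 1 of everything the β sub-cell writes): discharging `BetaPertH` makes Bałaban's UV stability UNCONDITIONAL — a
real constructive-QFT result; it is NOT the continuum limit and NOT the Clay problem.  HONEST DEPENDENCY (cell reorg 2026-08-19,
verbatim): «continuum YM on T⁴ ⇐ BetaPertH ∧ nine spine estimates (0/9 proved); BetaPertH ⇐ (D1) ∧ (D4) ∧ CAP+tail; G-an2-4 gates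
asym, D1 and NE2/3/4.»  THIS MODULE DISCHARGES NOTHING: [folklore] real analysis (finite sums, geometric tails of `tsum`s, one Bernoulli inequality) over node
U2's HYPOTHESIS SHAPES `T4BetaStationary.{SeqBox, MemoryProfile}` and `T4BetaFlowWellPosed.{MemFlow, drive}` on an ABSTRACT functional `B : (ℕ → ℝ) → ℝ` — the shapes
node U2 derives (`memoryProfile_betaInf`, `memFlow_gstar`) from its NE4 ∕ history-moduli LETTERS (NOT PRINTED for [I] = T. Bałaban, Commun. Math. Phys. **109** (1987)
[Balaban1987RG1]: GAPS G-t4-U2-1 ∕ -2; p. 298 says only that β_j depends on the preceding couplings); the reference profile is the shape of (0.31)'s lower half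
(Theorem 2 p. 259, STATED WITHOUT PROOF) in the continuum, which part 5 ∕ 6 derive for the limits of pinned families.  Nothing of Bałaban's β is asserted.

THE POINT.  Node U2's well-posedness (`T4BetaFlowWellPosed` §§3–5) makes the flow with memory a CONTRACTION in the sup distance, the floor `b ≤ B` turning the
linear growth of the driving sums into the AF weight `1∕b` (`mul_one_div_base_le`), under `C_m γ < b(1 − θ)`; without a floor nothing there survives (its §6
probes).  Here the floor is replaced, as on the lattice (gen 35), by ONE asymptotically free solution t and smallness of the pin: §12 — upward induction in the
physical scale m, the finer future beyond m charged `C_m γ∕(1 − θ)²` through the fading profile (the `tsum` split at age m − p − 1), the scales below m charged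
through the envelope 2e (induction hypothesis) and t's profile (`sum_invSprof_le`, the square root absorbed by `mul_sprof_le`): **`1∕(4e²) + (β*∕4)m ≤ 1∕h(m)²`**
for EVERY box solution h pinned at e with `4C_m e ≤ β*(1 − θ)`, `e²·(1∕t(0)² + C_mγ∕(1 − θ)² + (2C_m∕((1 − θ)β*))²) ≤ 3∕4`.  §13 — two box solutions h, h′ with the
same pin: Δ(m) = Σ_{p<m} [B(h_{>p}) − B(h′_{>p})], `|h − h′| ≤ h²h′|Δ| ≤ 8e³|Δ|` by §12's envelopes, and a bound `|Δ(q)| ≤ A∕θ₁^q` (θ < θ₁ < 1) PROPAGATES to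
`|Δ(m)| ≤ κA∕θ₁^m`, κ = 8C_m e³∕((1 − θ∕θ₁)(1 − θ₁)); the a-priori linear growth of Δ starts the iteration (Bernoulli), and κ < 1 — a condition on e ALONE — forces
Δ ≡ 0: **INTRINSIC UNIQUENESS of the box solution near zero pin, floor-free** (`memFlow_unique_of_reference`).

WHAT THIS FILE PROVES (0 sorry, 0 def): §12 `tsum_profile_split_le`, `geom_rev_le`, `le_invSprof_of_prof_le`, `abs_drive_sub_drive_le_of_envelope`,
**`invSq_lower_of_reference_flow`**, `le_two_mul_pin_of_reference_flow`; §13 `abs_sep_le_linear`, `sep_propagate`, **`memFlow_unique_of_reference`**.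
NOT CLAIMED: anything about Bałaban's β; existence of box solutions (node U2's Picard theorem keeps its floor; part 6 gives existence as limits of pinned
lattice families); `BetaPertH`; the continuum limit of the measures; Clay.
-/

namespace Summit.QuantumFields.BalabanUV.Beta.EriceFlowEnclosureB12AsPrintedHistoryContagionShiftFlow

open Finset Filter Topology
open Literature.MathematicalPhysics.QuantumFieldTheory.Balaban1983to89
open Literature.MathematicalPhysics.QuantumFieldTheory.Balaban1983to89.T4CouplingMatching (prof sprof sprof_pos sprof_sq prof_pos sprof_zero
  abs_sub_le_of_inv_sq)
open Literature.MathematicalPhysics.QuantumFieldTheory.Balaban1983to89.T4BetaStationary (SeqBox MemoryProfile summable_profile abs_sub_le_of_seqBox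
  tsum_profile_le)
open Literature.MathematicalPhysics.QuantumFieldTheory.Balaban1983to89.T4BetaFlowWellPosed (MemFlow drive drive_succ seqBox_shift invSq_eq_of_memFlow)
open Summit.QuantumFields.BalabanUV.Beta.EriceFlowEnclosureB12AsPrintedHistoryContagion (geom_old_le sprof_le_sprof mul_sprof_le)
open Summit.QuantumFields.BalabanUV.Beta.EriceFlowEnclosureB12AsPrintedHistoryUniformDepth (sum_invSprof_le)
open Summit.QuantumFields.BalabanUV.Beta.EriceFlowEnclosureB12AsPrintedHistoryContagionProfile (le_two_mul_of_profile)

noncomputable section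

/-! ## §12 The continuum contagion: every box solution pinned at a small coupling is asymptotically free -/

/-- THE `tsum` SPLIT AT AGE N: two box-valued histories whose first N entries are F-close have fading profile `Σ' θ^j|u_j − u′_j| ≤ F∕(1−θ) + γθ^N∕(1−θ)`
(the entries of age ≥ N cost γ each, geometrically discounted). [folklore] -/
theorem tsum_profile_split_le {θ γ : ℝ} (hθ0 : 0 ≤ θ) (hθ1 : θ < 1) {u u' : ℕ → ℝ} (hu : SeqBox γ u) (hu' : SeqBox γ u')
    (N : ℕ) {F : ℝ} (hF0 : 0 ≤ F) (hF : ∀ j, j < N → |u j - u' j| ≤ F) :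
    ∑' j, θ ^ j * |u j - u' j| ≤ F / (1 - θ) + γ * θ ^ N / (1 - θ) := by
  have h1θ : 0 < 1 - θ := by linarith
  have hs := summable_profile hθ0 hθ1 hu hu'
  rw [← hs.sum_add_tsum_nat_add N]
  have hfin : ∑ j ∈ range N, θ ^ j * |u j - u' j| ≤ F / (1 - θ) := by
    calc ∑ j ∈ range N, θ ^ j * |u j - u' j| ≤ ∑ j ∈ range N, θ ^ j * F :=
          Finset.sum_le_sum fun j hj => mul_le_mul_of_nonneg_left (hF j (mem_range.mp hj)) (pow_nonneg hθ0 j)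
      _ = (∑ j ∈ range N, θ ^ j) * F := by rw [Finset.sum_mul]
      _ ≤ (1 / (1 - θ)) * F := by
          refine mul_le_mul_of_nonneg_right ?_ hF0
          have h := geom_sum_Ico_le_of_lt_one (m := 0) (n := N) hθ0 hθ1
          rwa [Nat.Ico_zero_eq_range, pow_zero] at h
      _ = F / (1 - θ) := by ring
  have htail : ∑' j, θ ^ (j + N) * |u (j + N) - u' (j + N)| ≤ γ * θ ^ N / (1 - θ) := by
    have hg : Summable fun j : ℕ => (γ * θ ^ N) * θ ^ j := (summable_geometric_of_lt_one hθ0 hθ1).mul_left _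
    have hs' : Summable fun j : ℕ => θ ^ (j + N) * |u (j + N) - u' (j + N)| :=
      (summable_nat_add_iff N).mpr hs
    calc ∑' j, θ ^ (j + N) * |u (j + N) - u' (j + N)| ≤ ∑' j : ℕ, (γ * θ ^ N) * θ ^ j := by
          refine hs'.tsum_le_tsum (fun j => ?_) hg
          rw [pow_add]
          calc θ ^ j * θ ^ N * |u (j + N) - u' (j + N)| ≤ θ ^ j * θ ^ N * γ :=
                mul_le_mul_of_nonneg_left (abs_sub_le_of_seqBox hu hu' _) (by positivity)
            _ = γ * θ ^ N * θ ^ j := by ring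
      _ = γ * θ ^ N * ∑' j : ℕ, θ ^ j := tsum_mul_left
      _ = γ * θ ^ N / (1 - θ) := by rw [tsum_geometric_of_lt_one hθ0 hθ1, div_eq_mul_inv]
  linarith

/-- Reversed geometric row: `Σ_{p<m} θ^{m−1−p} ≤ 1∕(1−θ)`. [folklore] -/
theorem geom_rev_le {θ : ℝ} (hθ0 : 0 ≤ θ) (hθ1 : θ < 1) (m : ℕ) : ∑ p ∈ range m, θ ^ (m - 1 - p) ≤ 1 / (1 - θ) := by
  have h1θ : 0 < 1 - θ := by linarith
  rcases m with _ | m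
  · simp [h1θ.le]
  · have h := geom_old_le hθ0 hθ1 (le_refl m)
    rw [Nat.sub_self, pow_zero] at h
    simpa using h

/-- From the profile to the coupling: `1∕t_a² + β*·q ≤ 1∕t(q)²` ⟹ `t(q) ≤ 1∕√(1∕t_a² + β*·q)` (node U2's `sprof t_a β* q`). [folklore] -/
theorem le_invSprof_of_prof_le {ta bs : ℝ} {t : ℕ → ℝ} (hta : 0 < ta) (hbs : 0 ≤ bs) {q : ℕ} (htq : 0 < t q)
    (h : 1 / ta ^ 2 + bs * (q : ℝ) ≤ 1 / (t q) ^ 2) : t q ≤ 1 / sprof ta bs q := by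
  have hp0 := sprof_pos hta hbs q
  have hsq : (t q) ^ 2 ≤ (1 / sprof ta bs q) ^ 2 := by
    rw [one_div_pow, sprof_sq hta hbs, le_one_div (pow_pos htq 2) (prof_pos hta hbs _)]
    exact h
  exact (pow_le_pow_iff_left₀ htq.le (one_div_pos.mpr hp0).le two_ne_zero).mp hsq

/-- **THE DRIVING SUMS OF TWO SOLUTIONS UNDER AN ENVELOPE.**  `B` with memory profile `(C_m, θ)` on the box ]0, γ]^ℕ (0 ≤ θ < 1, C_m ≥ 0); two box histories h, t;
below the physical scale m, h is enveloped by E (`h(q) ≤ E`, q < m) and t by the AF profile (`t(q) ≤ 1∕√(1∕t_a² + β*q)`, all q).  Then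
`|drive B h m − drive B t m| ≤ C_mγ∕(1−θ)² + (C_m∕(1−θ))(E·m + (2∕β*)√(1∕t_a² + β*m))` — the future beyond m costs a CONSTANT, the enveloped past a linear term plus the
telescoped profile (`sum_invSprof_le`). [folklore] -/
theorem abs_drive_sub_drive_le_of_envelope {B : (ℕ → ℝ) → ℝ} {Cm θ γ bs ta E : ℝ} {h t : ℕ → ℝ}
    (hB : MemoryProfile Cm θ γ B) (hCm : 0 ≤ Cm) (hθ0 : 0 ≤ θ) (hθ1 : θ < 1) (hbs : 0 < bs) (hta : 0 < ta) (hE : 0 ≤ E)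
    (hhs : SeqBox γ h) (hts : SeqBox γ t) (htprof : ∀ q : ℕ, t q ≤ 1 / sprof ta bs q)
    {m : ℕ} (henv : ∀ q, q < m → h q ≤ E) :
    |drive B h m - drive B t m| ≤ Cm * γ / (1 - θ) ^ 2 + Cm / (1 - θ) * (E * (m : ℝ) + 2 / bs * sprof ta bs m) := by
  have h1θ : 0 < 1 - θ := by linarith
  have hγ : 0 ≤ γ := (hhs 0).1.le.trans (hhs 0).2
  have hp0 := sprof_pos hta hbs.le
  -- one memory term
  have hterm : ∀ p, p < m → |B (fun j => h (p + 1 + j)) - B (fun j => t (p + 1 + j))|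
      ≤ Cm * ((E + 1 / sprof ta bs (p + 1)) / (1 - θ) + γ * θ ^ (m - 1 - p) / (1 - θ)) := by
    intro p hp
    have hF0 : 0 ≤ E + 1 / sprof ta bs (p + 1) := add_nonneg hE (one_div_pos.mpr (hp0 _)).le
    have hF : ∀ j, j < m - 1 - p → |h (p + 1 + j) - t (p + 1 + j)| ≤ E + 1 / sprof ta bs (p + 1) := by
      intro j hj
      have hq : p + 1 + j < m := by omega
      have hhq := (hhs (p + 1 + j)).1
      have htq := (hts (p + 1 + j)).1
      have h1 : h (p + 1 + j) ≤ E := henv _ hq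
      have h2 : t (p + 1 + j) ≤ 1 / sprof ta bs (p + 1) :=
        (htprof _).trans (one_div_le_one_div_of_le (hp0 _) (sprof_le_sprof hbs.le (by omega)))
      rw [abs_le]; constructor <;> linarith
    have hsplit := tsum_profile_split_le hθ0 hθ1 (seqBox_shift hhs (p + 1)) (seqBox_shift hts (p + 1)) (m - 1 - p) hF0 hF
    exact (hB _ _ (seqBox_shift hhs (p + 1)) (seqBox_shift hts (p + 1))).trans (mul_le_mul_of_nonneg_left hsplit hCm)
  -- summing over p < m
  have hsum_sprof : ∑ p ∈ range m, 1 / sprof ta bs (p + 1) ≤ 2 / bs * sprof ta bs m := by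
    have h := sum_invSprof_le hta hbs m
    rw [Finset.sum_range_succ' (fun q => 1 / sprof ta bs q) m, sprof_zero hta, one_div_one_div] at h
    linarith
  unfold T4BetaFlowWellPosed.drive
  rw [← Finset.sum_sub_distrib]
  calc |∑ p ∈ range m, (B (fun j => h (p + 1 + j)) - B (fun j => t (p + 1 + j)))|
      ≤ ∑ p ∈ range m, |B (fun j => h (p + 1 + j)) - B (fun j => t (p + 1 + j))| := Finset.abs_sum_le_sum_abs _ _
    _ ≤ ∑ p ∈ range m, Cm * ((E + 1 / sprof ta bs (p + 1)) / (1 - θ) + γ * θ ^ (m - 1 - p) / (1 - θ)) :=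
        Finset.sum_le_sum fun p hp => hterm p (mem_range.mp hp)
    _ = ∑ p ∈ range m, (Cm / (1 - θ) * E + Cm / (1 - θ) * (1 / sprof ta bs (p + 1)) + Cm * γ / (1 - θ) * θ ^ (m - 1 - p)) :=
        Finset.sum_congr rfl fun p _ => by ring
    _ = Cm / (1 - θ) * (E * (m : ℝ) + ∑ p ∈ range m, 1 / sprof ta bs (p + 1)) + Cm * γ / (1 - θ) * ∑ p ∈ range m, θ ^ (m - 1 - p) := by
        rw [Finset.sum_add_distrib, Finset.sum_add_distrib, Finset.sum_const, card_range, nsmul_eq_mul, ← Finset.mul_sum,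
          ← Finset.mul_sum]
        ring
    _ ≤ Cm / (1 - θ) * (E * (m : ℝ) + 2 / bs * sprof ta bs m) + Cm * γ / (1 - θ) * (1 / (1 - θ)) :=
        add_le_add (mul_le_mul_of_nonneg_left (add_le_add le_rfl hsum_sprof) (by positivity))
          (mul_le_mul_of_nonneg_left (geom_rev_le hθ0 hθ1 m) (by positivity))
    _ = Cm * γ / (1 - θ) ^ 2 + Cm / (1 - θ) * (E * (m : ℝ) + 2 / bs * sprof ta bs m) := by
        field_simp
        ring

/-- **THE CONTINUUM CONTAGION.**  `B` with memory profile `MemoryProfile C_m θ γ B` (0 ≤ θ < 1, C_m ≥ 0); ONE box solution t of the flow with memory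
(`MemFlow B g* t`, `SeqBox γ t`) carrying an asymptotically free profile `1∕t_a² + β*·m ≤ 1∕t(m)²` (β* > 0, t_a > 0); ANY box solution h of `MemFlow B e h` whose pin
e satisfies `4C_m e ≤ β*(1 − θ)` and `e²·(1∕g*² + C_mγ∕(1 − θ)² + (2C_m∕((1 − θ)β*))²) ≤ 3∕4`.  THEN for every physical scale m:
**`1∕(4e²) + (β*∕4)·m ≤ 1∕h(m)²`** — h stays below 2e and is asymptotically free at a quarter of the reference rate; NO floor ∕ sign on B, NO condition tying γ to
(C_m, θ).  Strong induction on m: the hypothesis is the envelope below m, `abs_drive_sub_drive_le_of_envelope` the step, `mul_sprof_le` the absorption.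
[cite: Balaban1987RG1, Thm 2 (0.31) p.259 with (0.20) p.256 and p.298] -/
theorem invSq_lower_of_reference_flow {B : (ℕ → ℝ) → ℝ} {Cm θ γ bs ta gs e : ℝ} {t h : ℕ → ℝ}
    (hB : MemoryProfile Cm θ γ B) (hCm : 0 ≤ Cm) (hθ0 : 0 ≤ θ) (hθ1 : θ < 1) (hbs : 0 < bs) (hta : 0 < ta)
    (hts : SeqBox γ t) (htf : MemFlow B gs t) (hprof : ∀ m : ℕ, 1 / ta ^ 2 + bs * (m : ℝ) ≤ 1 / (t m) ^ 2)
    (hhs : SeqBox γ h) (hhf : MemFlow B e h)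
    (hs1 : 4 * Cm * e ≤ bs * (1 - θ))
    (hs2 : e ^ 2 * (1 / gs ^ 2 + Cm * γ / (1 - θ) ^ 2 + (2 * Cm / ((1 - θ) * bs)) ^ 2) ≤ 3 / 4) :
    ∀ m : ℕ, 1 / (4 * e ^ 2) + bs / 4 * (m : ℝ) ≤ 1 / (h m) ^ 2 := by
  have h1θ : 0 < 1 - θ := by linarith
  have he : 0 < e := by rw [← hhf.1]; exact (hhs 0).1
  have hgs : 0 < gs := by rw [← htf.1]; exact (hts 0).1
  have hγ : 0 ≤ γ := (hhs 0).1.le.trans (hhs 0).2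
  have htprof : ∀ q : ℕ, t q ≤ 1 / sprof ta bs q := fun q => le_invSprof_of_prof_le hta hbs.le (hts q).1 (hprof q)
  -- the constant budget
  have hQ : 1 / gs ^ 2 + Cm * γ / (1 - θ) ^ 2 + (2 * Cm / ((1 - θ) * bs)) ^ 2 ≤ 3 / (4 * e ^ 2) := by
    rw [le_div_iff₀ (by positivity)]; linarith
  intro m
  induction m using Nat.strong_induction_on with
  | _ m ih =>
    have henv : ∀ q, q < m → h q ≤ 2 * e := fun q hq =>
      le_two_mul_of_profile hbs.le he (hhs q).1 (Nat.cast_nonneg q) (ih q hq)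
    have hD := abs_drive_sub_drive_le_of_envelope hB hCm hθ0 hθ1 hbs hta (by positivity) hhs hts htprof henv
    have hx : 1 / (h m) ^ 2 = 1 / e ^ 2 + drive B h m := invSq_eq_of_memFlow hhf m
    have hy : 1 / (t m) ^ 2 = 1 / gs ^ 2 + drive B t m := invSq_eq_of_memFlow htf m
    have hyt : 1 / ta ^ 2 + bs * (m : ℝ) - 1 / gs ^ 2 ≤ drive B t m := by linarith [hprof m]
    have hab := mul_sprof_le hta hbs.le (2 * Cm / ((1 - θ) * bs)) m
    have hprofm : prof ta bs m = 1 / ta ^ 2 + bs * (m : ℝ) := rfl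
    have hlin : Cm / (1 - θ) * (2 * e) ≤ bs / 2 := by
      rw [div_mul_eq_mul_div, div_le_iff₀ h1θ]; linarith
    have hlin' : Cm / (1 - θ) * (2 * e * (m : ℝ)) ≤ bs / 2 * (m : ℝ) := by
      calc Cm / (1 - θ) * (2 * e * (m : ℝ)) = Cm / (1 - θ) * (2 * e) * (m : ℝ) := by ring
        _ ≤ bs / 2 * (m : ℝ) := mul_le_mul_of_nonneg_right hlin (Nat.cast_nonneg m)
    have hsq : Cm / (1 - θ) * (2 / bs * sprof ta bs m) = 2 * Cm / ((1 - θ) * bs) * sprof ta bs m := by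
      field_simp
    have hDle := (abs_sub_le_iff.mp hD).2
    have hta2 : 0 ≤ 1 / ta ^ 2 := by positivity
    have hdist : Cm / (1 - θ) * (2 * e * (m : ℝ) + 2 / bs * sprof ta bs m)
        = Cm / (1 - θ) * (2 * e * (m : ℝ)) + Cm / (1 - θ) * (2 / bs * sprof ta bs m) := mul_add _ _ _
    have e14 : 1 / (4 * e ^ 2) = 1 / e ^ 2 - 3 / (4 * e ^ 2) := by
      field_simp
      ring
    rw [hprofm] at hab
    linarith [hx, hyt, hDle, hab, hlin', hQ, hsq, hdist, e14, hta2]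

/-- **EVERY BOX SOLUTION PINNED AT A SMALL COUPLING STAYS BELOW TWICE ITS PIN**: `h(m) ≤ 2e` for all m. [folklore] -/
theorem le_two_mul_pin_of_reference_flow {B : (ℕ → ℝ) → ℝ} {Cm θ γ bs ta gs e : ℝ} {t h : ℕ → ℝ}
    (hB : MemoryProfile Cm θ γ B) (hCm : 0 ≤ Cm) (hθ0 : 0 ≤ θ) (hθ1 : θ < 1) (hbs : 0 < bs) (hta : 0 < ta)
    (hts : SeqBox γ t) (htf : MemFlow B gs t) (hprof : ∀ m : ℕ, 1 / ta ^ 2 + bs * (m : ℝ) ≤ 1 / (t m) ^ 2)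
    (hhs : SeqBox γ h) (hhf : MemFlow B e h)
    (hs1 : 4 * Cm * e ≤ bs * (1 - θ))
    (hs2 : e ^ 2 * (1 / gs ^ 2 + Cm * γ / (1 - θ) ^ 2 + (2 * Cm / ((1 - θ) * bs)) ^ 2) ≤ 3 / 4) :
    ∀ m : ℕ, h m ≤ 2 * e := fun m =>
  le_two_mul_of_profile hbs.le (by rw [← hhf.1]; exact (hhs 0).1) (hhs m).1 (Nat.cast_nonneg m)
    (invSq_lower_of_reference_flow hB hCm hθ0 hθ1 hbs hta hts htf hprof hhs hhf hs1 hs2 m)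

/-! ## §13 Intrinsic uniqueness near zero pin: the θ₁-weighted contraction over all physical scales -/

/-- A-priori growth of the separation of two box solutions with the same pin: `|1∕h(q)² − 1∕h′(q)²| ≤ q·C_mγ∕(1−θ)` (each memory term costs at most `C_mγ∕(1−θ)`).
[folklore] -/
theorem abs_sep_le_linear {B : (ℕ → ℝ) → ℝ} {Cm θ γ e : ℝ} {h h' : ℕ → ℝ}
    (hB : MemoryProfile Cm θ γ B) (hCm : 0 ≤ Cm) (hθ0 : 0 ≤ θ) (hθ1 : θ < 1)
    (hhs : SeqBox γ h) (hhs' : SeqBox γ h') (hhf : MemFlow B e h) (hhf' : MemFlow B e h') (q : ℕ) :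
    |1 / (h q) ^ 2 - 1 / (h' q) ^ 2| ≤ (q : ℝ) * (Cm * (γ / (1 - θ))) := by
  rw [invSq_eq_of_memFlow hhf q, invSq_eq_of_memFlow hhf' q, add_sub_add_left_eq_sub]
  unfold T4BetaFlowWellPosed.drive
  rw [← Finset.sum_sub_distrib]
  refine (Finset.abs_sum_le_sum_abs _ _).trans ?_
  calc ∑ p ∈ range q, |B (fun j => h (p + 1 + j)) - B (fun j => h' (p + 1 + j))| ≤ ∑ p ∈ range q, Cm * (γ / (1 - θ)) :=
        Finset.sum_le_sum fun p _ => (hB _ _ (seqBox_shift hhs (p + 1)) (seqBox_shift hhs' (p + 1))).trans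
          (mul_le_mul_of_nonneg_left (tsum_profile_le hθ0 hθ1 (seqBox_shift hhs (p + 1)) (seqBox_shift hhs' (p + 1))) hCm)
    _ = (q : ℝ) * (Cm * (γ / (1 - θ))) := by rw [Finset.sum_const, card_range, nsmul_eq_mul]

/-- **THE PROPAGATION STEP.**  Two box solutions h, h′ of `MemFlow B e ·` (same pin), both enveloped by 2e (`h, h′ ≤ 2e`), `B` with memory profile `(C_m, θ)`,
a second rate `θ < θ₁ < 1`.  If `|1∕h(q)² − 1∕h′(q)²| ≤ A∕θ₁^q` for ALL q, then `|1∕h(m)² − 1∕h′(m)²| ≤ κ·A∕θ₁^m` for all m with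
`κ = 8C_m e³∕((1 − θ∕θ₁)(1 − θ₁))`: telescoped driving sums, `|h − h′| ≤ h²h′·|Δ| ≤ 8e³|Δ|`, the profile `Σ_j θ^j θ₁^{−(p+1+j)} = θ₁^{−(p+1)}∕(1 − θ∕θ₁)` and
`Σ_{p<m} θ₁^{−(p+1)} ≤ θ₁^{−m}∕(1 − θ₁)`. [folklore] -/
theorem sep_propagate {B : (ℕ → ℝ) → ℝ} {Cm θ θ₁ γ e A : ℝ} {h h' : ℕ → ℝ}
    (hB : MemoryProfile Cm θ γ B) (hCm : 0 ≤ Cm) (hθ0 : 0 ≤ θ) (hθθ₁ : θ < θ₁) (hθ₁1 : θ₁ < 1) (he : 0 ≤ e)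
    (hhs : SeqBox γ h) (hhs' : SeqBox γ h') (hhf : MemFlow B e h) (hhf' : MemFlow B e h')
    (henv : ∀ q, h q ≤ 2 * e) (henv' : ∀ q, h' q ≤ 2 * e)
    (hA : ∀ q : ℕ, |1 / (h q) ^ 2 - 1 / (h' q) ^ 2| ≤ A / θ₁ ^ q) :
    ∀ m : ℕ, |1 / (h m) ^ 2 - 1 / (h' m) ^ 2| ≤ 8 * Cm * e ^ 3 / ((1 - θ / θ₁) * (1 - θ₁)) * A / θ₁ ^ m := by
  have hθ₁0 : 0 < θ₁ := lt_of_le_of_lt hθ0 hθθ₁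
  have hr0 : 0 ≤ θ / θ₁ := div_nonneg hθ0 hθ₁0.le
  have hr1 : θ / θ₁ < 1 := (div_lt_one hθ₁0).mpr hθθ₁
  have h1r : 0 < 1 - θ / θ₁ := by linarith
  have h1θ₁ : 0 < 1 - θ₁ := by linarith
  have hA0 : 0 ≤ A := by
    have h0 := hA 0
    rw [pow_zero, div_one] at h0
    exact (abs_nonneg _).trans h0
  -- one memory term: Cm Σ' θ^j |h − h'|(p+1+j) ≤ Cm · 8e³ · A θ₁^{-(p+1)} /(1 − θ/θ₁)
  have hterm : ∀ p : ℕ, |B (fun j => h (p + 1 + j)) - B (fun j => h' (p + 1 + j))|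
      ≤ Cm * (8 * e ^ 3 * A / (1 - θ / θ₁) * (1 / θ₁ ^ (p + 1))) := by
    intro p
    have hs := summable_profile hθ0 (hθθ₁.trans hθ₁1) (seqBox_shift hhs (p + 1)) (seqBox_shift hhs' (p + 1))
    have hg : Summable fun j : ℕ => (8 * e ^ 3 * A * (1 / θ₁ ^ (p + 1))) * (θ / θ₁) ^ j :=
      (summable_geometric_of_lt_one hr0 hr1).mul_left _
    refine (hB _ _ (seqBox_shift hhs (p + 1)) (seqBox_shift hhs' (p + 1))).trans (mul_le_mul_of_nonneg_left ?_ hCm)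
    calc ∑' j, θ ^ j * |h (p + 1 + j) - h' (p + 1 + j)| ≤ ∑' j : ℕ, (8 * e ^ 3 * A * (1 / θ₁ ^ (p + 1))) * (θ / θ₁) ^ j := by
          refine hs.tsum_le_tsum (fun j => ?_) hg
          have hq := (hhs (p + 1 + j)).1
          have hq' := (hhs' (p + 1 + j)).1
          have hw : (h (p + 1 + j)) ^ 2 * h' (p + 1 + j) ≤ 8 * e ^ 3 := by
            have h1 : (h (p + 1 + j)) ^ 2 ≤ (2 * e) ^ 2 := pow_le_pow_left₀ hq.le (henv _) 2
            calc (h (p + 1 + j)) ^ 2 * h' (p + 1 + j) ≤ (2 * e) ^ 2 * (2 * e) := mul_le_mul h1 (henv' _) hq'.le (by positivity)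
              _ = 8 * e ^ 3 := by ring
          have hd : |h (p + 1 + j) - h' (p + 1 + j)| ≤ 8 * e ^ 3 * (A / θ₁ ^ (p + 1 + j)) :=
            (abs_sub_le_of_inv_sq hq hq').trans (mul_le_mul hw (hA _) (abs_nonneg _) (by positivity))
          have e1 : θ ^ j * (8 * e ^ 3 * (A / θ₁ ^ (p + 1 + j))) = 8 * e ^ 3 * A * (1 / θ₁ ^ (p + 1)) * (θ / θ₁) ^ j := by
            rw [div_pow, pow_add]; field_simp
          calc θ ^ j * |h (p + 1 + j) - h' (p + 1 + j)| ≤ θ ^ j * (8 * e ^ 3 * (A / θ₁ ^ (p + 1 + j))) :=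
                mul_le_mul_of_nonneg_left hd (pow_nonneg hθ0 j)
            _ = 8 * e ^ 3 * A * (1 / θ₁ ^ (p + 1)) * (θ / θ₁) ^ j := e1
      _ = 8 * e ^ 3 * A * (1 / θ₁ ^ (p + 1)) * ∑' j : ℕ, (θ / θ₁) ^ j := tsum_mul_left
      _ = 8 * e ^ 3 * A / (1 - θ / θ₁) * (1 / θ₁ ^ (p + 1)) := by
          rw [tsum_geometric_of_lt_one hr0 hr1]; field_simp
  -- the reversed geometric row in 1/θ₁: Σ_{p<m} θ₁^{-(p+1)} ≤ θ₁^{-m}/(1−θ₁)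
  have hrow : ∀ m : ℕ, ∑ p ∈ range m, 1 / θ₁ ^ (p + 1) ≤ 1 / θ₁ ^ m / (1 - θ₁) := by
    intro m
    have e1 : ∑ p ∈ range m, 1 / θ₁ ^ (p + 1) = 1 / θ₁ ^ m * ∑ p ∈ range m, θ₁ ^ (m - 1 - p) := by
      rw [Finset.mul_sum]
      refine Finset.sum_congr rfl fun p hp => ?_
      have hpm : p + 1 ≤ m := mem_range.mp hp
      have e2 : θ₁ ^ m = θ₁ ^ (p + 1) * θ₁ ^ (m - 1 - p) := by rw [← pow_add]; congr 1; omega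
      rw [e2]; field_simp
    rw [e1, div_eq_mul_one_div (1 / θ₁ ^ m)]
    exact mul_le_mul_of_nonneg_left (geom_rev_le hθ₁0.le hθ₁1 m) (by positivity)
  intro m
  rw [invSq_eq_of_memFlow hhf m, invSq_eq_of_memFlow hhf' m, add_sub_add_left_eq_sub]
  unfold T4BetaFlowWellPosed.drive
  rw [← Finset.sum_sub_distrib]
  calc |∑ p ∈ range m, (B (fun j => h (p + 1 + j)) - B (fun j => h' (p + 1 + j)))|
      ≤ ∑ p ∈ range m, |B (fun j => h (p + 1 + j)) - B (fun j => h' (p + 1 + j))| := Finset.abs_sum_le_sum_abs _ _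
    _ ≤ ∑ p ∈ range m, Cm * (8 * e ^ 3 * A / (1 - θ / θ₁) * (1 / θ₁ ^ (p + 1))) := Finset.sum_le_sum fun p _ => hterm p
    _ = Cm * (8 * e ^ 3 * A / (1 - θ / θ₁)) * ∑ p ∈ range m, 1 / θ₁ ^ (p + 1) := by
        rw [Finset.mul_sum]; refine Finset.sum_congr rfl fun p _ => by ring
    _ ≤ Cm * (8 * e ^ 3 * A / (1 - θ / θ₁)) * (1 / θ₁ ^ m / (1 - θ₁)) := mul_le_mul_of_nonneg_left (hrow m) (by positivity)
    _ = 8 * Cm * e ^ 3 / ((1 - θ / θ₁) * (1 - θ₁)) * A / θ₁ ^ m := by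
        field_simp

/-- **INTRINSIC UNIQUENESS OF THE BOX SOLUTION NEAR ZERO PIN — FLOOR-FREE.**  `B` with memory profile `MemoryProfile C_m θ γ B` (0 ≤ θ < 1, C_m ≥ 0); ONE box solution t
of `MemFlow B g* t` with the AF profile `1∕t_a² + β*·m ≤ 1∕t(m)²`; two box solutions h, h′ of the flow with the SAME pin e (`MemFlow B e h`, `MemFlow B e h′`, `SeqBox γ`),
e below the threshold: `4C_m e ≤ β*(1 − θ)`, `e²·(1∕g*² + C_mγ∕(1 − θ)² + (2C_m∕((1 − θ)β*))²) ≤ 3∕4`, `64·C_m e³ ≤ (1 − θ)²`.  THEN **h = h′**.  Node U2's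
`T4BetaFlowWellPosed.memFlow_unique` ∕ `eq_gstar_of_memFlow` with the floor `b ≤ B` and `C_m γ < b(1 − θ)` DELETED in favour of ONE asymptotically free solution and
smallness of the pin (§12 envelopes both; `sep_propagate` at θ₁ = (1+θ)∕2 contracts by κ ≤ ½ from the a-priori linear bound `abs_sep_le_linear`; κ^n → 0).
[cite: Balaban1987RG1, Thm 2 (0.31) p.259 with (0.20) p.256 and p.298] -/
theorem memFlow_unique_of_reference {B : (ℕ → ℝ) → ℝ} {Cm θ γ bs ta gs e : ℝ} {t h h' : ℕ → ℝ}
    (hB : MemoryProfile Cm θ γ B) (hCm : 0 ≤ Cm) (hθ0 : 0 ≤ θ) (hθ1 : θ < 1) (hbs : 0 < bs) (hta : 0 < ta)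
    (hts : SeqBox γ t) (htf : MemFlow B gs t) (hprof : ∀ m : ℕ, 1 / ta ^ 2 + bs * (m : ℝ) ≤ 1 / (t m) ^ 2)
    (hhs : SeqBox γ h) (hhf : MemFlow B e h) (hhs' : SeqBox γ h') (hhf' : MemFlow B e h')
    (hs1 : 4 * Cm * e ≤ bs * (1 - θ))
    (hs2 : e ^ 2 * (1 / gs ^ 2 + Cm * γ / (1 - θ) ^ 2 + (2 * Cm / ((1 - θ) * bs)) ^ 2) ≤ 3 / 4)
    (hs4 : 64 * Cm * e ^ 3 ≤ (1 - θ) ^ 2) : h = h' := by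
  have h1θ : 0 < 1 - θ := by linarith
  have he : 0 < e := by rw [← hhf.1]; exact (hhs 0).1
  have hγ : 0 ≤ γ := (hhs 0).1.le.trans (hhs 0).2
  have henv := le_two_mul_pin_of_reference_flow hB hCm hθ0 hθ1 hbs hta hts htf hprof hhs hhf hs1 hs2
  have henv' := le_two_mul_pin_of_reference_flow hB hCm hθ0 hθ1 hbs hta hts htf hprof hhs' hhf' hs1 hs2
  -- the second rate θ₁ = (1+θ)/2 and the contraction factor κ ≤ 1/2
  set θ₁ : ℝ := (1 + θ) / 2 with hθ₁
  have hθθ₁ : θ < θ₁ := by rw [hθ₁]; linarith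
  have hθ₁1 : θ₁ < 1 := by rw [hθ₁]; linarith
  have hθ₁0 : 0 < θ₁ := lt_of_le_of_lt hθ0 hθθ₁
  have h1θ₁ : 1 - θ₁ = (1 - θ) / 2 := by rw [hθ₁]; ring
  have h1θ₁0 : 0 < 1 - θ₁ := by rw [h1θ₁]; linarith
  have h1r : (1 - θ) / 2 ≤ 1 - θ / θ₁ := by
    have : θ / θ₁ ≤ (1 + θ) / 2 := by
      rw [div_le_iff₀ hθ₁0, hθ₁]; nlinarith [sq_nonneg (1 - θ)]
    linarith
  set κ : ℝ := 8 * Cm * e ^ 3 / ((1 - θ / θ₁) * (1 - θ₁)) with hκ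
  have hκ0 : 0 ≤ κ := by rw [hκ]; exact div_nonneg (by positivity) (mul_nonneg (by linarith) (by linarith))
  have hκ1 : κ ≤ 1 / 2 := by
    rw [hκ, div_le_iff₀ (mul_pos (by linarith) (by linarith)), h1θ₁]
    have hprod : (1 - θ) / 2 * ((1 - θ) / 2) ≤ (1 - θ / θ₁) * ((1 - θ) / 2) :=
      mul_le_mul_of_nonneg_right h1r (by linarith)
    nlinarith
  -- a-priori bound A₀ / θ₁^q from the linear growth (Bernoulli: q(1−θ₁) ≤ θ₁^{-q})
  set A₀ : ℝ := Cm * (γ / (1 - θ)) / (1 - θ₁) with hA₀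
  have hA₀0 : 0 ≤ A₀ := by rw [hA₀]; exact div_nonneg (by positivity) (by linarith)
  have hstart : ∀ q : ℕ, |1 / (h q) ^ 2 - 1 / (h' q) ^ 2| ≤ A₀ / θ₁ ^ q := by
    intro q
    have hlin := abs_sep_le_linear hB hCm hθ0 hθ1 hhs hhs' hhf hhf' q
    have hbern : (q : ℝ) * (1 - θ₁) ≤ 1 / θ₁ ^ q := by
      have ha : (0 : ℝ) ≤ 1 / θ₁ - 1 := by
        rw [sub_nonneg, le_div_iff₀ hθ₁0]; linarith
      have hb := one_add_mul_le_pow (a := 1 / θ₁ - 1) (by linarith) q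
      rw [show 1 + (1 / θ₁ - 1) = 1 / θ₁ by ring, one_div_pow] at hb
      have e1 : (q : ℝ) * (1 / θ₁ - 1) = (q : ℝ) * (1 - θ₁) / θ₁ := by field_simp
      rw [e1] at hb
      have h2 : (q : ℝ) * (1 - θ₁) / θ₁ ≥ (q : ℝ) * (1 - θ₁) := by
        have hq0 : (0 : ℝ) ≤ (q : ℝ) := Nat.cast_nonneg q
        rw [ge_iff_le, le_div_iff₀ hθ₁0]
        have := mul_le_mul_of_nonneg_left hθ₁1.le (mul_nonneg hq0 h1θ₁0.le)
        simpa using this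
      linarith
    calc |1 / (h q) ^ 2 - 1 / (h' q) ^ 2| ≤ (q : ℝ) * (Cm * (γ / (1 - θ))) := hlin
      _ = ((q : ℝ) * (1 - θ₁)) * (Cm * (γ / (1 - θ)) / (1 - θ₁)) := by
          have hne : (1 - θ₁) ≠ 0 := ne_of_gt h1θ₁0
          field_simp
      _ ≤ (1 / θ₁ ^ q) * (Cm * (γ / (1 - θ)) / (1 - θ₁)) := mul_le_mul_of_nonneg_right hbern hA₀0
      _ = A₀ / θ₁ ^ q := by rw [hA₀]; ring
  -- iterate the propagation: |Δ q| ≤ κ^n A₀ / θ₁^q for every n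
  have hiter : ∀ n : ℕ, ∀ q : ℕ, |1 / (h q) ^ 2 - 1 / (h' q) ^ 2| ≤ κ ^ n * A₀ / θ₁ ^ q := by
    intro n
    induction n with
    | zero => intro q; simpa using hstart q
    | succ n ih =>
      intro q
      have hp := sep_propagate (A := κ ^ n * A₀) hB hCm hθ0 hθθ₁ hθ₁1 he.le hhs hhs' hhf hhf' henv henv' ih q
      calc |1 / (h q) ^ 2 - 1 / (h' q) ^ 2| ≤ 8 * Cm * e ^ 3 / ((1 - θ / θ₁) * (1 - θ₁)) * (κ ^ n * A₀) / θ₁ ^ q := hp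
        _ = κ ^ (n + 1) * A₀ / θ₁ ^ q := by rw [← hκ, pow_succ]; ring
  -- κ^n → 0 forces Δ ≡ 0
  funext q
  have hq := (hhs q).1
  have hq' := (hhs' q).1
  have hlim : Tendsto (fun n : ℕ => κ ^ n * A₀ / θ₁ ^ q) atTop (𝓝 (0 * A₀ / θ₁ ^ q)) :=
    ((tendsto_pow_atTop_nhds_zero_of_lt_one hκ0 (by linarith)).mul_const A₀).div_const _
  rw [zero_mul, zero_div] at hlim
  have h0 : |1 / (h q) ^ 2 - 1 / (h' q) ^ 2| ≤ 0 := ge_of_tendsto' hlim fun n => hiter n q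
  have heq : 1 / (h q) ^ 2 = 1 / (h' q) ^ 2 := sub_eq_zero.mp (abs_eq_zero.mp (le_antisymm h0 (abs_nonneg _)))
  have hsq : (h q) ^ 2 = (h' q) ^ 2 := by
    have := congrArg (fun x : ℝ => 1 / x) heq
    simpa only [one_div_one_div] using this
  exact (pow_left_inj₀ hq.le hq'.le two_ne_zero).mp hsq

end

end Summit.QuantumFields.BalabanUV.Beta.EriceFlowEnclosureB12AsPrintedHistoryContagionShiftFlow
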